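import Summits.Ventures.Crystal3D.Theorems.StickyWulffConstantGenericWallFloorHRowEndCore
import Summits.Ventures.Crystal3D.Theorems.StickyWulffConstantGenericWallFloorHStarSymmetry
import Summits.Ventures.Crystal3D.Theorems.StickyWulffConstantGenericWallFloorChamber
import Summits.Ventures.Crystal3D.Theorems.StickyWulffConstantGenericWallFloorHRowEndFarApartDefs
import HarnessLib

/-!
# `HRowEndFarApart (3/4)` and the registered `HRowEndFarApart (21/25)` — PROVED (TRACK 2′ closes lane T's `stub_hRowEndFarApart` by name)
# (crux `GenericWallFloor`, stmt-Ventures-19480, kernel G; machine owner 19480-p2 g14, 2026-08-29)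

HONEST FRAMING. Venture `Summits/Ventures/Crystal3D` (cell `crystal3d-full`), route `route-Ventures-StickyWulffConstant`, helper for the crux
`GenericWallFloor` (stmt-Ventures-19480) / consumer `TextureLiminfV5` (stmt-Ventures-23912).  Standard axioms; no `sorry`; F-C1 not moved.
This file discharges the LAYER ROWS named input `HRowEndFarApart (21/25)` (lane T v8.14+ `stub_hRowEndFarApart`, def in `…HRowEndFarApartDefs`)
UNCONDITIONALLY: `hRowEndFarApart_holds : HRowEndFarApart (21 / 25)`, from the sharp `hRowEndFarApart_three_quarters : HRowEndFarApart (3 / 4)`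
(the threshold `3/4` is exact: the owner's rigid catalogue has the isolated apart arrival at `cos = −1/3`, rise `0.431`, steepness `0.7454 < 3/4`).

THE ARGUMENT.  `hRowEnd_core` (`…HRowEndCore`) is the theorem for the model row direction `u₀ = (1,0,0)`.  A general in-plane slot `u` is `R u₀` for a
product `R` of at most two VERTICAL MIRRORS (mirrors across in-plane slots); such an `R` maps the c-dozen `fccSlots` and the h-dozen `hcpSlots` into
themselves and commutes with the basal mirror, hence fixes the model lattice `Λ₀` (`image_fcc_eq_of_mapsTo_fccSlots`, via dozen rigidity) and
conjugates the basal twin frame; replacing `F` by `F ∘ R` transports every hypothesis of `HRowEndFarApart` to the model direction (`hRowEnd_of_symmetry`).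
The vacancy hypothesis (`e`'s own h-dozen not full) is not needed.
-/

noncomputable section

namespace Summit.Ventures.Crystal3D.Theorems

open Finset HRowEndModel
open Literature.MathematicalPhysics.StatisticalMechanics
open scoped InnerProductSpace

/-! ### Vertical mirrors preserve both dozens and commute with the basal mirror -/

/-- **The mirror across ANY slot maps the c-dozen into itself** (`⟪s, v⟫ ∈ {1, ½, 0, −½, −1}` and the slot closure rules). -/
theorem reflect_mem_fccSlots {v s : EuclideanSpace ℝ (Fin 3)} (hv : v ∈ fccSlots) (hs : s ∈ fccSlots) :
    (ℝ ∙ v)ᗮ.reflection s ∈ fccSlots := by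
  have hvn : ‖v‖ = 1 := norm_eq_one_of_mem_fccSlots hv
  have hsn : ‖s‖ = 1 := norm_eq_one_of_mem_fccSlots hs
  rw [reflection_unit_apply hvn]
  rcases inner_slots_mem hs hv with h | h | h | h | h
  · have hsv : s = v := by
      have h0 : ‖s - v‖ ^ 2 = 0 := by rw [@norm_sub_sq_real, hsn, hvn, h]; ring
      rwa [sq_eq_zero_iff, norm_eq_zero, sub_eq_zero] at h0
    rw [h, hsv, show v - (2 * (1 : ℝ)) • v = -v by module]
    exact neg_mem_fccSlots hv
  · rw [h, show s - (2 * (1 / 2 : ℝ)) • v = s - v by module]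
    exact sub_mem_fccSlots_of_inner_eq_half hs hv h
  · rw [h, mul_zero, zero_smul, sub_zero]; exact hs
  · rw [h, show s - (2 * (-(1 / 2) : ℝ)) • v = s + v by module]
    exact add_mem_fccSlots_of_inner_eq_neg_half hs hv h
  · have hsv : s = -v := by
      have h0 : ‖s + v‖ ^ 2 = 0 := by rw [@norm_add_sq_real, hsn, hvn, h]; ring
      rwa [sq_eq_zero_iff, norm_eq_zero, add_eq_zero_iff_eq_neg] at h0
    rw [h, hsv, show -v - (2 * (-1 : ℝ)) • v = v by module]
    exact hv

/-- **An isometry mapping the c-dozen into itself fixes the model lattice `Λ₀`** (dozen rigidity with the three independent slots `u₀, t₁, t₃`). -/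
theorem image_fcc_eq_of_mapsTo_fccSlots (R : EuclideanSpace ℝ (Fin 3) ≃ₗᵢ[ℝ] EuclideanSpace ℝ (Fin 3))
    (hR : ∀ s ∈ fccSlots, R s ∈ fccSlots) : R '' fccStacking 1 (Real.sqrt (2 / 3)) = fccStacking 1 (Real.sqrt (2 / 3)) := by
  have hind : LinearIndependent ℝ ![u₀, t₁, t₃] :=
    linearIndependent_of_pairwise_half u₀_mem t₁_mem t₃_mem (by rw [real_inner_comm]; exact inner_t₁_u₀)
      (by rw [real_inner_comm]; exact inner_t₃_u₀) (by rw [real_inner_comm]; exact inner_t₃_t₁)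
  have mem : ∀ {s : EuclideanSpace ℝ (Fin 3)}, s ∈ fccSlots →
      R s ∈ (LinearIsometryEquiv.refl ℝ (EuclideanSpace ℝ (Fin 3))) '' fccStacking 1 (Real.sqrt (2 / 3)) :=
    fun hs => ⟨R _, mem_fcc_of_mem_fccSlots (hR _ hs), rfl⟩
  have key := movedFcc_eq_of_three_independent_slots R (LinearIsometryEquiv.refl ℝ (EuclideanSpace ℝ (Fin 3))) u₀_mem t₁_mem
    t₃_mem (mem u₀_mem) (mem t₁_mem) (mem t₃_mem) hind
  rw [key, LinearIsometryEquiv.coe_refl, Set.image_id]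

/-- **Vertical mirrors commute with the basal mirror.** -/
theorem basalMirror_reflect_comm {v : EuclideanSpace ℝ (Fin 3)} (hv : v ∈ fccSlots) (hv2 : v 2 = 0) (x : EuclideanSpace ℝ (Fin 3)) :
    basalMirror ((ℝ ∙ v)ᗮ.reflection x) = (ℝ ∙ v)ᗮ.reflection (basalMirror x) := by
  have hvn : ‖v‖ = 1 := norm_eq_one_of_mem_fccSlots hv
  have hbv : basalMirror v = v := by
    ext t
    rw [basalMirror_apply_coord]
    split_ifs with ht
    · rw [ht, hv2, neg_zero]
    · rfl
  have hin : ⟪basalMirror x, v⟫_ℝ = ⟪x, v⟫_ℝ := by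
    conv_lhs => rw [← hbv]
    rw [LinearIsometryEquiv.inner_map_map]
  rw [reflection_unit_apply hvn, reflection_unit_apply hvn, map_sub, LinearIsometryEquiv.map_smul, hbv, hin]

/-! ### Transport of the core theorem along a symmetry of the two dozens -/

/-- **Transport.**  If `R` maps both dozens into themselves and commutes with the basal mirror, the h-row END theorem holds for the row direction
`R u₀`: replace `F` by `F ∘ R` in `hRowEnd_core`. -/
theorem hRowEnd_of_symmetry (R : EuclideanSpace ℝ (Fin 3) ≃ₗᵢ[ℝ] EuclideanSpace ℝ (Fin 3))
    (hRc : ∀ s ∈ fccSlots, R s ∈ fccSlots) (hRh : ∀ s ∈ hcpSlots, R s ∈ hcpSlots) (hRb : ∀ x, basalMirror (R x) = R (basalMirror x))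
    {X : Finset (EuclideanSpace ℝ (Fin 3))} (hX : ∀ p ∈ X, ∀ q ∈ X, p ≠ q → 1 ≤ dist p q)
    {F F' : EuclideanSpace ℝ (Fin 3) ≃ₗᵢ[ℝ] EuclideanSpace ℝ (Fin 3)} {q ζ e : EuclideanSpace ℝ (Fin 3)} (hq : q ∈ fccSlots)
    (hζ : ‖ζ‖ = 1) (hsteep : (3 : ℝ) / 4 ≤ ⟪F (R u₀), ζ⟫_ℝ) (hrise : (3 : ℝ) / 8 ≤ ⟪F' q, ζ⟫_ℝ)
    (hA : F' '' fccStacking 1 (Real.sqrt (2 / 3)) ≠ F '' fccStacking 1 (Real.sqrt (2 / 3)))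
    (hB : F' '' fccStacking 1 (Real.sqrt (2 / 3)) ≠
      (twinFrame F (F (EuclideanSpace.single (2 : Fin 3) (1 : ℝ)))) '' fccStacking 1 (Real.sqrt (2 / 3)))
    (hp0 : e - F (R u₀) ∈ X) (hfull : ∀ s ∈ hcpSlots, e - F (R u₀) + F s ∈ X) (hcert : WalkCertified12 X e ⟨F', q, 0⟩) : False := by
  have hRF : ∀ x, (R.trans F) x = F (R x) := fun x => rfl
  have hfcc := image_fcc_eq_of_mapsTo_fccSlots R hRc
  have hA' : F' '' fccStacking 1 (Real.sqrt (2 / 3)) ≠ (R.trans F) '' fccStacking 1 (Real.sqrt (2 / 3)) := by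
    rw [LinearIsometryEquiv.coe_trans, Set.image_comp, hfcc]; exact hA
  have htwin : ⇑(twinFrame (R.trans F) ((R.trans F) (EuclideanSpace.single (2 : Fin 3) (1 : ℝ)))) =
      ⇑(twinFrame F (F (EuclideanSpace.single (2 : Fin 3) (1 : ℝ)))) ∘ ⇑R := by
    funext w
    rw [Function.comp_apply, twinFrame_axis_apply, twinFrame_axis_apply, hRF, hRb]
  have hB' : F' '' fccStacking 1 (Real.sqrt (2 / 3)) ≠
      (twinFrame (R.trans F) ((R.trans F) (EuclideanSpace.single (2 : Fin 3) (1 : ℝ)))) '' fccStacking 1 (Real.sqrt (2 / 3)) := by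
    rw [htwin, Set.image_comp, hfcc]; exact hB
  have hfull' : ∀ s ∈ hcpSlots, e - (R.trans F) u₀ + (R.trans F) s ∈ X := by
    intro s hs
    rw [hRF, hRF]
    exact hfull (R s) (hRh s hs)
  exact hRowEnd_core hX hq hζ (F := R.trans F) (by rw [hRF]; exact hsteep) hrise hA' hB' (by rw [hRF]; exact hp0) hfull' hcert

/-! ### Every in-plane slot is `R u₀` for a product of vertical mirrors -/

/-- **Symmetry reduction.**  For every in-plane slot `u` there is a product `R` of at most two vertical mirrors with `R u₀ = u`; it maps both dozens
into themselves and commutes with the basal mirror. -/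
theorem exists_symmetry_apply_u₀ {u : EuclideanSpace ℝ (Fin 3)} (hu : u ∈ fccSlots) (hu2 : u 2 = 0) :
    ∃ R : EuclideanSpace ℝ (Fin 3) ≃ₗᵢ[ℝ] EuclideanSpace ℝ (Fin 3), R u₀ = u ∧ (∀ s ∈ fccSlots, R s ∈ fccSlots) ∧
      (∀ s ∈ hcpSlots, R s ∈ hcpSlots) ∧ ∀ x, basalMirror (R x) = R (basalMirror x) := by
  have hu₀n : ‖u₀‖ = 1 := norm_eq_one_of_mem_fccSlots u₀_mem
  have hun : ‖u‖ = 1 := norm_eq_one_of_mem_fccSlots hu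
  have hnu₀ : -u₀ ∈ fccSlots := neg_mem_fccSlots u₀_mem
  -- one vertical mirror
  have one : ∀ {v : EuclideanSpace ℝ (Fin 3)}, v ∈ fccSlots → v 2 = 0 →
      (∀ s ∈ fccSlots, (ℝ ∙ v)ᗮ.reflection s ∈ fccSlots) ∧ (∀ s ∈ hcpSlots, (ℝ ∙ v)ᗮ.reflection s ∈ hcpSlots) ∧
        ∀ x, basalMirror ((ℝ ∙ v)ᗮ.reflection x) = (ℝ ∙ v)ᗮ.reflection (basalMirror x) :=
    fun hv hv2 => ⟨fun s hs => reflect_mem_fccSlots hv hs, fun s hs => reflect_mem_hcpSlots hv hv2 hs, basalMirror_reflect_comm hv hv2⟩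
  -- two vertical mirrors
  have two : ∀ {v w : EuclideanSpace ℝ (Fin 3)}, v ∈ fccSlots → v 2 = 0 → w ∈ fccSlots → w 2 = 0 →
      (∀ s ∈ fccSlots, ((ℝ ∙ v)ᗮ.reflection.trans (ℝ ∙ w)ᗮ.reflection) s ∈ fccSlots) ∧
      (∀ s ∈ hcpSlots, ((ℝ ∙ v)ᗮ.reflection.trans (ℝ ∙ w)ᗮ.reflection) s ∈ hcpSlots) ∧
        ∀ x, basalMirror (((ℝ ∙ v)ᗮ.reflection.trans (ℝ ∙ w)ᗮ.reflection) x) =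
          ((ℝ ∙ v)ᗮ.reflection.trans (ℝ ∙ w)ᗮ.reflection) (basalMirror x) := by
    intro v w hv hv2 hw hw2
    refine ⟨fun s hs => ?_, fun s hs => ?_, fun x => ?_⟩
    · rw [LinearIsometryEquiv.trans_apply]; exact reflect_mem_fccSlots hw (reflect_mem_fccSlots hv hs)
    · rw [LinearIsometryEquiv.trans_apply]; exact reflect_mem_hcpSlots hw hw2 (reflect_mem_hcpSlots hv hv2 hs)
    · rw [LinearIsometryEquiv.trans_apply, LinearIsometryEquiv.trans_apply, basalMirror_reflect_comm hw hw2,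
        basalMirror_reflect_comm hv hv2]
  rcases inner_slots_mem u₀_mem hu with h | h | h | h | h
  · -- `u = u₀`: the square of the mirror across `u₀`
    have hsv : u = u₀ := by
      have h0 : ‖u₀ - u‖ ^ 2 = 0 := by rw [@norm_sub_sq_real, hu₀n, hun, h]; ring
      rw [sq_eq_zero_iff, norm_eq_zero, sub_eq_zero] at h0
      exact h0.symm
    obtain ⟨h1, h2, h3⟩ := two u₀_mem u₀_two u₀_mem u₀_two
    refine ⟨_, ?_, h1, h2, h3⟩
    rw [LinearIsometryEquiv.trans_apply, reflection_slot_self hu₀n, map_neg, reflection_slot_self hu₀n, neg_neg, hsv]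
  · -- `⟪u₀, u⟫ = ½`: the mirror across `u₀ − u`
    have hvs : u₀ - u ∈ fccSlots := sub_mem_fccSlots_of_inner_eq_half u₀_mem hu h
    have hv2 : (u₀ - u) 2 = 0 := by rw [PiLp.sub_apply, u₀_two, hu2, sub_zero]
    have hvn : ‖u₀ - u‖ = 1 := norm_eq_one_of_mem_fccSlots hvs
    have hwv : ⟪u₀, u₀ - u⟫_ℝ = 1 / 2 := by rw [inner_sub_right, real_inner_self_eq_norm_sq, hu₀n, h]; norm_num
    obtain ⟨h1, h2, h3⟩ := one hvs hv2
    exact ⟨_, by rw [reflection_slot_of_inner_half hvn hwv, sub_sub_cancel], h1, h2, h3⟩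
  · -- two in-plane slots are never orthogonal
    exfalso
    rcases inPlane_slot_cases hu hu2 with rfl | rfl | rfl | rfl | rfl | rfl <;>
      · rw [u₀, inner_inPlane_sites] at h; push_cast at h; norm_num at h
  · -- `⟪u₀, u⟫ = −½`: the mirror across `u₀`, then the mirror across `−u₀ − u`
    have h' : ⟪-u₀, u⟫_ℝ = 1 / 2 := by rw [inner_neg_left, h]; norm_num
    have hws : -u₀ - u ∈ fccSlots := sub_mem_fccSlots_of_inner_eq_half hnu₀ hu h'
    have hw2 : (-u₀ - u) 2 = 0 := by rw [PiLp.sub_apply, PiLp.neg_apply, u₀_two, hu2, neg_zero, sub_zero]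
    have hwn : ‖-u₀ - u‖ = 1 := norm_eq_one_of_mem_fccSlots hws
    have hwv : ⟪-u₀, -u₀ - u⟫_ℝ = 1 / 2 := by
      rw [inner_sub_right, real_inner_self_eq_norm_sq, norm_neg, hu₀n, h']; norm_num
    obtain ⟨h1, h2, h3⟩ := two u₀_mem u₀_two hws hw2
    refine ⟨_, ?_, h1, h2, h3⟩
    rw [LinearIsometryEquiv.trans_apply, reflection_slot_self hu₀n, reflection_slot_of_inner_half hwn hwv, sub_sub_cancel]
  · -- `u = −u₀`: the mirror across `u₀`
    have hsv : u = -u₀ := by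
      have h0 : ‖u₀ + u‖ ^ 2 = 0 := by rw [@norm_add_sq_real, hu₀n, hun, h]; ring
      rw [sq_eq_zero_iff, norm_eq_zero, add_comm, add_eq_zero_iff_eq_neg] at h0
      exact h0
    obtain ⟨h1, h2, h3⟩ := one u₀_mem u₀_two
    exact ⟨_, by rw [reflection_slot_self hu₀n, hsv], h1, h2, h3⟩

/-! ### The theorems -/

/-- **`HRowEndFarApart (3/4)`** — the sharp form of the LAYER ROWS input (J-b′): an h-row END ball (predecessor h-FULL) carries no strongly certified
state `⟨F′, q, 0⟩` with `F′·Λ₀` apart from `F·Λ₀` and its basal twin that rises `≥ 3/8` along a unit vertical of row steepness `≥ 3/4`. -/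
theorem hRowEndFarApart_three_quarters : HRowEndFarApart (3 / 4) := by
  intro F F' u hu hu2 q hq ζ hζ hsteep hrise hA hB X hX e _ hp hfull _ hcert
  obtain ⟨R, hRu, hRc, hRh, hRb⟩ := exists_symmetry_apply_u₀ hu hu2
  subst hRu
  exact hRowEnd_of_symmetry R hRc hRh hRb hX hq hζ hsteep hrise hA hB hp hfull hcert

/-- **`HRowEndFarApart (21/25)` — PROVED**: the statement registered as lane T's `stub_hRowEndFarApart` (TexShadow v8.14+), by monotonicity in the
steepness from the sharp `3/4` form. -/
theorem hRowEndFarApart_holds : HRowEndFarApart (21 / 25) :=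
  hRowEndFarApart_three_quarters.mono (by norm_num)

end Summit.Ventures.Crystal3D.Theorems

end
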